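import Summits.ABC.StewartYu.PadicG3TwoFunctions
import Summits.ABC.StewartYu.FeldmanZeroDirectionWeights
import HarnessLib

/-!
# Cell abc-stewartyu, Gen-3 frame at `p = 2` (crux `Y07Two`, stmt-ABC-19659), layer F1/F7: NESTERENKO'S
# `Y₀`-BASIS `Δ(Y₀; ℓ, H)` AS THE FRAME'S `Rᵢ` — degree, integrality/size of its Hasse weights at integers
# (`den₀ = ν(H)^t`, `M₀`), and the `2`-adic coefficient bound (`Bw`) that the frame layers take as hypotheses

`Summits/ABC/StewartYu/PadicG3TwoFeldmanBasis.lean` — cell `abc-stewartyu` (HOME `run/shared/lean/pub/abc-stewartyu/`),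
route `PadicPrimesKummerThird`, seat p3 (g5), F-two LEAD.  One definition (the rational polynomial
`feldR ℓ H = num/den = Δ(Y₀; ℓ, H)`) and theorems; no named fact.

The frame layers `PadicG3TwoFunctions` / `Values` / `Siegel` / `Series` / `(Slab)KStep` are generic in the
`Y₀`-factors `Rᵢ ∈ ℚ[Y₀]` and carry three hypotheses about them: (i) `natDegree Rᵢ ≤ D₀`;
(ii) `den₀·(Hasse_{t₀} Rᵢ)(x) = z₀ ∈ ℤ`, `|z₀| ≤ M₀` at integer points; (iii) `‖coeffₖ(Hasse_{t₀} Rᵢ)‖₂·ρᵏ ≤ Bw`.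
For Nesterenko's choice `Rᵢ = Δ(Y₀; ℓ₀(i), H)` (LNM 1819 (3.1), (3.22)) they are discharged here from the
tree's `FeldmanDelta` (NW 1996 Lemma 4: `num`, `den`, `den_dvd_lcmUpto_pow_mul_coeff_taylor`) and p2-g4's
`DirWeights.zeroWeight` (`cast_zeroWeight`, `abs_zeroWeight_le`):
* `natDegree_feldR_le : natDegree (feldR ℓ H) ≤ ℓ`;
* `lcm_pow_mul_hasse_feldR_eq_zeroWeight : ν(H)^t · (Hasse_t feldR)(x) = zeroWeight ℓ H t x` (an INTEGER), with
  `|zeroWeight| ≤ ν(H)^t·e^{H/e}·(e(1+|x|/H))^ℓ` (`abs_zeroWeight_le`) — so `den₀ := ν(H)^t`;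
* `norm_coeff_hw_feldR_le : ‖coeffₖ(hw feldR t)‖₂ ≤ ‖(den ℓ H)⁻¹‖₂` (the Hasse derivative of the INTEGER
  polynomial `num` has integer coefficients) and `norm_coeff_hw_feldR_mul_pow_le : ‖coeffₖ‖·ρᵏ ≤ ‖den⁻¹‖₂·ρ^ℓ`
  for `ρ ≥ 1` — so `Bw := max_ℓ ‖den(ℓ,H)⁻¹‖₂·(4·2^m)^{L₀}` (the `Y₀`-line of the ledger).

WHAT THIS IS NOT: no choice of `H, L₀` (record); no crux moves.

References: Yu. V. Nesterenko, LNM 1819 (2003), §3.1 (3.1)–(3.2), Prop. 3.1; Yu. V. Nesterenko, M. Waldschmidt,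
Mat. Zapiski 2 (1996), §4 Lemma 4.
-/

noncomputable section

open Finset Polynomial
open scoped Nat
open Literature.NumberTheory.Transcendental (FeldmanDelta.num FeldmanDelta.den)
open Literature.NumberTheory.Transcendental.FeldmanDelta

namespace Summit.ABC.StewartYu.FeldmanBasis

/-- **Nesterenko's `Δ(Y₀; ℓ, H) = num/den`** as a rational polynomial (the frame's `Y₀`-factor `R_{ℓ}`).
[cite: Nesterenko2003, §3.1 (3.1)] -/
def feldR (ℓ H : ℕ) : ℚ[X] := C ((den ℓ H : ℚ)⁻¹) * num ℚ ℓ H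

/-- `deg Δ(Y₀; ℓ, H) ≤ ℓ`. [cite: Nesterenko2003, §3.1] -/
theorem natDegree_feldR_le (ℓ H : ℕ) : (feldR ℓ H).natDegree ≤ ℓ := by
  unfold feldR
  exact (natDegree_C_mul_le _ _).trans (natDegree_num_le ℓ H)

/-- `Hasse_t (C c · f) = C c · Hasse_t f`. [folklore] -/
theorem hasseDeriv_C_mul {K : Type*} [CommRing K] (c : K) (f : K[X]) (t : ℕ) :
    hasseDeriv t (C c * f) = C c * hasseDeriv t f := by
  rw [← smul_eq_C_mul, ← smul_eq_C_mul, LinearMap.map_smul]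

/-- `(Hasse_t Δ)(x) = (Hasse_t num)(x) / den`. [folklore] -/
theorem hasseDeriv_feldR_eval (ℓ H t : ℕ) (x : ℚ) :
    (hasseDeriv t (feldR ℓ H)).eval x = (hasseDeriv t (num ℚ ℓ H)).eval x / den ℓ H := by
  unfold feldR
  rw [hasseDeriv_C_mul, eval_mul, eval_C, div_eq_inv_mul]

/-- **Integrality of the normalised Hasse weight at an integer point**:
`ν(H)^t · (Hasse_t Δ(Y₀; ℓ, H))(x) = zeroWeight ℓ H t x ∈ ℤ` (`H ≥ 1`).
[cite: Nesterenko2003, §3.1 Prop 3.1 (1)] -/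
theorem lcm_pow_mul_hasse_feldR_eq_zeroWeight (ℓ : ℕ) {H : ℕ} (hH : 1 ≤ H) (t : ℕ) (x : ℤ) :
    (((Nat.lcmUpto H) ^ t : ℕ) : ℚ) * (hasseDeriv t (feldR ℓ H)).eval (x : ℚ) =
      (DirWeights.zeroWeight ℓ H t x : ℚ) := by
  rw [DirWeights.cast_zeroWeight ℚ ℓ hH t x, hasseDeriv_feldR_eval]
  push_cast
  ring

/-- **The `hR` hypothesis of the frame layers for `Rᵢ = Δ(Y₀; ℓ, H)`**: with `den₀ := ν(H)^t`,
`den₀·(Hasse_t R)(x) = z₀ ∈ ℤ` and `|z₀| ≤ M₀` as soon as `M₀ ≥ ν(H)^t·e^{H/e}·(e(1+|x|/H))^ℓ`.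
[cite: Nesterenko2003, §3.1 Prop 3.1] -/
theorem exists_int_lcm_pow_mul_hasse_feldR (ℓ : ℕ) {H : ℕ} (hH : 1 ≤ H) (t : ℕ) (x : ℤ) {M₀ : ℤ}
    (hM : (Nat.lcmUpto H : ℝ) ^ t *
      (Real.exp (H / Real.exp 1) * (Real.exp 1 * (1 + |(x : ℝ)| / H)) ^ ℓ) ≤ M₀) :
    ∃ z₀ : ℤ, (((Nat.lcmUpto H) ^ t : ℕ) : ℚ) * (hasseDeriv t (feldR ℓ H)).eval (x : ℚ) = z₀ ∧ |z₀| ≤ M₀ := by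
  refine ⟨DirWeights.zeroWeight ℓ H t x, lcm_pow_mul_hasse_feldR_eq_zeroWeight ℓ hH t x, ?_⟩
  have h := (DirWeights.abs_zeroWeight_le ℓ hH t x).trans hM
  exact_mod_cast h

/-! ### The `2`-adic size of the coefficients -/

/-- The coefficients of `num ℚ` are integers. [folklore] -/
theorem coeff_num_rat_eq_intCast (ℓ H k : ℕ) : (num ℚ ℓ H).coeff k = (((num ℤ ℓ H).coeff k : ℤ) : ℚ) := by
  rw [← DirWeights.map_num (Int.castRingHom ℚ) ℓ H, coeff_map, eq_intCast]

/-- The coefficients of `Hasse_t num ℚ` are integers. [folklore] -/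
theorem exists_int_coeff_hasseDeriv_num (ℓ H t k : ℕ) :
    ∃ z : ℤ, (hasseDeriv t (num ℚ ℓ H)).coeff k = (z : ℚ) := by
  refine ⟨((k + t).choose t : ℤ) * (num ℤ ℓ H).coeff (k + t), ?_⟩
  rw [hasseDeriv_coeff, coeff_num_rat_eq_intCast]
  push_cast
  ring

/-- **`‖coeffₖ(hw Δ t)‖₂ ≤ ‖den⁻¹‖₂`**: the `2`-adic size of the coefficients of the frame's `Y₀`-weight
polynomial `hw R i t = (Hasse_t Δ(Y₀; ℓ, H)).map (ℚ → ℚ₂)`. [cite: Nesterenko2003, §3.1; shape only] -/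
theorem norm_coeff_hw_feldR_le {ι : Type*} (ℓ₀ : ι → ℕ) (H : ℕ) (i : ι) (t k : ℕ) :
    ‖(TwoSetup.hw (fun i => feldR (ℓ₀ i) H) i t).coeff k‖ ≤ ‖((den (ℓ₀ i) H : ℚ_[2]))⁻¹‖ := by
  unfold TwoSetup.hw feldR
  rw [hasseDeriv_C_mul, Polynomial.coeff_map, coeff_C_mul]
  obtain ⟨z, hz⟩ := exists_int_coeff_hasseDeriv_num (ℓ₀ i) H t k
  rw [hz, map_mul, eq_ratCast, eq_ratCast]
  push_cast
  rw [norm_mul]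
  exact mul_le_of_le_one_right (norm_nonneg _) (Padic.norm_int_le_one z)

/-- **The `hBw` hypothesis of the frame layers for the Fel'dman basis**: for a weight radius `ρ ≥ 1`,
`‖coeffₖ(hw Δ t)‖₂·ρᵏ ≤ ‖den⁻¹‖₂·ρ^ℓ` (coefficients vanish beyond the degree `ℓ`).
[cite: Nesterenko2003, §3.1; shape only] -/
theorem norm_coeff_hw_feldR_mul_pow_le {ι : Type*} (ℓ₀ : ι → ℕ) (H : ℕ) (i : ι) (t k : ℕ) {ρ : ℝ}
    (hρ1 : 1 ≤ ρ) :
    ‖(TwoSetup.hw (fun i => feldR (ℓ₀ i) H) i t).coeff k‖ * ρ ^ k ≤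
      ‖((den (ℓ₀ i) H : ℚ_[2]))⁻¹‖ * ρ ^ (ℓ₀ i) := by
  by_cases hk : k ≤ ℓ₀ i
  · exact mul_le_mul (norm_coeff_hw_feldR_le ℓ₀ H i t k) (pow_le_pow_right₀ hρ1 hk) (by positivity)
      (norm_nonneg _)
  · -- beyond the degree the coefficient vanishes
    have hdeg : (TwoSetup.hw (fun i => feldR (ℓ₀ i) H) i t).natDegree < k := by
      unfold TwoSetup.hw
      have h1 : (hasseDeriv t (feldR (ℓ₀ i) H)).natDegree ≤ ℓ₀ i :=
        (natDegree_hasseDeriv_le _ _).trans ((Nat.sub_le _ _).trans (natDegree_feldR_le _ _))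
      exact lt_of_le_of_lt ((natDegree_map_le).trans h1) (by omega)
    rw [coeff_eq_zero_of_natDegree_lt hdeg, norm_zero, zero_mul]
    positivity

end Summit.ABC.StewartYu.FeldmanBasis

end
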